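import Literature.NumberTheory.LFunctions.Zhang2022.Section10Defs
import Literature.NumberTheory.LFunctions.Zhang2022.Section8ClosedForm

/-!
# Zhang (2022) §10 / (2.33): exact evaluation of the integrals `d_{3j}, …, d_{6j}`, `d_{7j}`

Trunk T-ANT (NumberTheory/LFunctions). Companion of `Section10Defs.lean` (Y. Zhang,
arXiv:2211.02515v1, §10 and §18 [Zhang2022LandauSiegel]; an unrefereed manuscript under
adjudication — this file only does calculus on the printed definitions).

Every integrand of §10 and of the (2.33) computation is a finite sum of products
(linear × `e^{kπiz}`) × (quadratic polynomial), possibly shifted (`z ↦ z + s`) or reflected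
(`z ↦ c − z`): `𝔣𝔣_{a,k}(z) = (1 + aπiz)e^{kπiz}`, `𝔤𝔥 = r₀ + (r₁ + bπiz)e^{−kπiz}`, times `1`, `z`,
`0.002 − z`, `−1 − jπi(z − 0.5)`, or a `𝔶𝔶` (quadratic). Hence each is a sum of terms
`(c₀ + c₁z + c₂z² + c₃z³)e^{mπiz}` (`m ∈ ℚ`, `m = 0` allowed). This file provides that small
calculus once — coefficient records `LinE` (`u₀ + u₁z`), `QuadP` (`v₀ + v₁z + v₂z²`), `CubE`
(`c₀ + … + c₃z³`), the rate `m` being carried separately as a rational literal; the operations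
`shift`, `reflect`, `mulQ`, `smul` with their pointwise soundness lemmas; and the exact integral
`CubE.integ` over `[A, B]` (`A, B ∈ ℚ`) by the fundamental theorem of calculus with the explicit
antiderivative `(A₀ + A₁z + A₂z² + A₃z³)e^{mπiz}`, `A₃ = wc₃`, `A₂ = w(c₂ − 3A₃)`, `A₁ = w(c₁ − 2A₂)`,
`A₀ = w(c₀ − A₁)`, `w = 1/(mπi)` (`CubE.integral_eq`; for `m = 0` the polynomial antiderivative) —
and then the closed forms `d3F_eq, d4F_eq, d5pF_eq, d5F_eq, d6pF_eq, d6F_eq, d7F_eq` of every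
integral of `Section10Defs`, generic in the rational parameters `a` of `𝔣𝔣ⱼμ`, `(r₀, r₁, b)` of
`𝔤𝔥ⱼμ` and `(s, h)` of `𝔶𝔶μⱼ` (the rates `3/2`, `5/2` of (8.13)–(8.18) are fixed). The only
transcendental quantities left are `π`, `1/π` and `e^{θπi}` at rational `θ`, which
`Section10Certificate.lean` encloses rigorously (it mirrors every definition of this file box by box,
which is why real scalars are written as coercions `((q : ℚ) : ℝ) : ℂ)` on the right, `π²` as
`((π·π : ℝ) : ℂ)`, small integers as `((n : ℤ) : ℂ)`).
-/

noncomputable section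

open Complex Real intervalIntegral ComplexConjugate

namespace Literature.NumberTheory.LFunctions.Zhang2022

/-! ### Exp-polynomial records and their denotations -/

/-- `e^{θπi}` for rational `θ` (the shape the interval engine encloses). [folklore] -/
def eIpi (θ : ℚ) : ℂ := cexp ((((θ : ℝ) * π : ℝ) : ℂ) * I)

/-- Coefficients `(u₀, u₁)` of a "linear × exponential" `(u₀ + u₁z)e^{mπiz}` (rate `m` kept apart). [folklore] -/
structure LinE where
  /-- constant coefficient -/
  u0 : ℂ
  /-- linear coefficient -/
  u1 : ℂ

/-- Coefficients of a quadratic polynomial `v₀ + v₁z + v₂z²`. [folklore] -/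
structure QuadP where
  /-- constant coefficient -/
  v0 : ℂ
  /-- linear coefficient -/
  v1 : ℂ
  /-- quadratic coefficient -/
  v2 : ℂ

/-- Coefficients of a "cubic × exponential" `(c₀ + c₁z + c₂z² + c₃z³)e^{mπiz}` (rate `m` kept apart). [folklore] -/
structure CubE where
  /-- constant coefficient -/
  c0 : ℂ
  /-- linear coefficient -/
  c1 : ℂ
  /-- quadratic coefficient -/
  c2 : ℂ
  /-- cubic coefficient -/
  c3 : ℂ

/-- `(u₀ + u₁z)e^{mπiz}`. [folklore] -/
def LinE.eval (t : LinE) (m : ℚ) (z : ℝ) : ℂ := (t.u0 + t.u1 * z) * cexp (m * π * I * z)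

/-- `v₀ + v₁z + v₂z²`. [folklore] -/
def QuadP.eval (q : QuadP) (z : ℝ) : ℂ := q.v0 + q.v1 * z + q.v2 * (z * z)

/-- `(c₀ + c₁z + c₂z² + c₃z³)e^{mπiz}`. [folklore] -/
def CubE.eval (t : CubE) (m : ℚ) (z : ℝ) : ℂ :=
  (t.c0 + t.c1 * z + t.c2 * (z * z) + t.c3 * (z * z * z)) * cexp (m * π * I * z)

/-- `CubE.eval` is continuous in `z`. [folklore] -/
@[fun_prop] theorem CubE.continuous_eval (t : CubE) (m : ℚ) : Continuous (fun z => t.eval m z) := by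
  unfold CubE.eval; fun_prop

/-- `LinE.eval` is continuous in `z`. [folklore] -/
@[fun_prop] theorem LinE.continuous_eval (t : LinE) (m : ℚ) : Continuous (fun z => t.eval m z) := by
  unfold LinE.eval; fun_prop

/-- `QuadP.eval` is continuous. [folklore] -/
@[fun_prop] theorem QuadP.continuous_eval (q : QuadP) : Continuous (fun z => q.eval z) := by
  unfold QuadP.eval; fun_prop

/-! ### Operations -/

/-- `𝔣𝔣_{a,k}` as a record: `(1 + aπi·z)e^{kπiz}`. [folklore] -/
def ffLin (a : ℚ) : LinE := ⟨1, (a : ℂ) * π * I⟩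

/-- constant part `r₀` of `𝔤𝔥` (rate `0`). [folklore] -/
def gh0Lin (r0 : ℚ) : LinE := ⟨(r0 : ℂ), 0⟩

/-- oscillating part `(r₁ + bπiz)e^{−kπiz}` of `𝔤𝔥` (rate `−k`). [folklore] -/
def gh1Lin (r1 b : ℚ) : LinE := ⟨(r1 : ℂ), (b : ℂ) * π * I⟩

/-- `ffF a k z = (ffLin a).eval k z`. [folklore] -/
theorem ffF_eq_eval (a k : ℚ) (z : ℝ) : ffF a k z = (ffLin a).eval k z := by
  unfold ffF ffLin LinE.eval; ring

/-- `ghF r₀ r₁ b k z = (gh0Lin r₀).eval 0 z + (gh1Lin r₁ b).eval (−k) z`. [folklore] -/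
theorem ghF_eq_eval (r0 r1 b k : ℚ) (z : ℝ) :
    ghF r0 r1 b k z = (gh0Lin r0).eval 0 z + (gh1Lin r1 b).eval (-k) z := by
  unfold ghF gh0Lin gh1Lin LinE.eval
  have e : cexp (-((k : ℂ) * π * I * z)) = cexp (((-k : ℚ) : ℂ) * π * I * z) := by
    congr 1; push_cast; ring
  rw [e]; push_cast; simp

/-- shift `z ↦ s + z`: `(u₀ + u₁(s+z))e^{mπi(s+z)} = e^{mπis}((u₀ + u₁s) + u₁z)e^{mπiz}`. [folklore] -/
def LinE.shift (t : LinE) (m s : ℚ) : LinE :=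
  ⟨eIpi (m * s) * (t.u0 + t.u1 * (((s : ℚ) : ℝ) : ℂ)), eIpi (m * s) * t.u1⟩

/-- Soundness of `LinE.shift`. [folklore] -/
theorem LinE.eval_shift (t : LinE) (m s : ℚ) (z : ℝ) :
    t.eval m (((s : ℚ) : ℝ) + z) = (t.shift m s).eval m z := by
  unfold LinE.eval LinE.shift eIpi
  have e : cexp ((m : ℂ) * π * I * (((((s : ℚ) : ℝ) + z : ℝ)) : ℂ))
      = cexp ((((((m * s : ℚ) : ℝ)) * π : ℝ) : ℂ) * I) * cexp ((m : ℂ) * π * I * z) := by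
    rw [← Complex.exp_add]; congr 1; push_cast; ring
  rw [e]; push_cast; ring

/-- reflection `z ↦ c − z`: `(u₀ + u₁(c−z))e^{mπi(c−z)} = e^{mπic}((u₀ + u₁c) − u₁z)e^{−mπiz}`. [folklore] -/
def LinE.reflect (t : LinE) (m c : ℚ) : LinE :=
  ⟨eIpi (m * c) * (t.u0 + t.u1 * (((c : ℚ) : ℝ) : ℂ)), -(eIpi (m * c) * t.u1)⟩

/-- Soundness of `LinE.reflect`. [folklore] -/
theorem LinE.eval_reflect (t : LinE) (m c : ℚ) (z : ℝ) :
    t.eval m (((c : ℚ) : ℝ) - z) = (t.reflect m c).eval (-m) z := by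
  unfold LinE.eval LinE.reflect eIpi
  have e : cexp ((m : ℂ) * π * I * (((((c : ℚ) : ℝ) - z : ℝ)) : ℂ))
      = cexp ((((((m * c : ℚ) : ℝ)) * π : ℝ) : ℂ) * I) * cexp (((-m : ℚ) : ℂ) * π * I * z) := by
    rw [← Complex.exp_add]; congr 1; push_cast; ring
  rw [e]; push_cast; ring

/-- product with a quadratic: `(u₀ + u₁z)(v₀ + v₁z + v₂z²)`. [folklore] -/
def LinE.mulQ (t : LinE) (q : QuadP) : CubE :=
  ⟨t.u0 * q.v0, t.u0 * q.v1 + t.u1 * q.v0, t.u0 * q.v2 + t.u1 * q.v1, t.u1 * q.v2⟩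

/-- Soundness of `LinE.mulQ` (linear-exponential on the left). [folklore] -/
theorem LinE.eval_mul_quad (t : LinE) (q : QuadP) (m : ℚ) (z : ℝ) :
    t.eval m z * q.eval z = (t.mulQ q).eval m z := by
  unfold LinE.eval QuadP.eval LinE.mulQ CubE.eval; ring

/-- Soundness of `LinE.mulQ` (quadratic on the left). [folklore] -/
theorem QuadP.eval_mul_lin (t : LinE) (q : QuadP) (m : ℚ) (z : ℝ) :
    q.eval z * t.eval m z = (t.mulQ q).eval m z := by
  unfold LinE.eval QuadP.eval LinE.mulQ CubE.eval; ring

/-- a linear-exponential as a cubic-exponential. [folklore] -/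
def LinE.toCubE (t : LinE) : CubE := ⟨t.u0, t.u1, 0, 0⟩

/-- Soundness of `LinE.toCubE`. [folklore] -/
theorem LinE.eval_toCubE (t : LinE) (m : ℚ) (z : ℝ) : t.eval m z = t.toCubE.eval m z := by
  unfold LinE.eval LinE.toCubE CubE.eval; ring

/-- scalar multiple (scalar on the left in the denotation). [folklore] -/
def CubE.smul (t : CubE) (w : ℂ) : CubE := ⟨w * t.c0, w * t.c1, w * t.c2, w * t.c3⟩

/-- Soundness of `CubE.smul`, scalar on the left. [folklore] -/
theorem CubE.smul_eval (t : CubE) (w : ℂ) (m : ℚ) (z : ℝ) : w * t.eval m z = (t.smul w).eval m z := by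
  unfold CubE.eval CubE.smul; ring

/-- Soundness of `CubE.smul`, scalar on the right. [folklore] -/
theorem CubE.eval_mul (t : CubE) (w : ℂ) (m : ℚ) (z : ℝ) : t.eval m z * w = (t.smul w).eval m z := by
  unfold CubE.eval CubE.smul; ring

/-- coefficientwise negation. [folklore] -/
def CubE.neg (t : CubE) : CubE := ⟨-t.c0, -t.c1, -t.c2, -t.c3⟩

/-- Soundness of `CubE.neg`. [folklore] -/
theorem CubE.neg_eval (t : CubE) (m : ℚ) (z : ℝ) : -(t.eval m z) = t.neg.eval m z := by
  unfold CubE.eval CubE.neg; ring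

/-- shift of a quadratic: `q(s + z)`. [folklore] -/
def QuadP.shift (q : QuadP) (s : ℚ) : QuadP :=
  ⟨q.v0 + q.v1 * (((s : ℚ) : ℝ) : ℂ) + q.v2 * (((s * s : ℚ) : ℝ) : ℂ),
   q.v1 + q.v2 * (((2 * s : ℚ) : ℝ) : ℂ), q.v2⟩

/-- Soundness of `QuadP.shift`. [folklore] -/
theorem QuadP.eval_shift (q : QuadP) (s : ℚ) (z : ℝ) :
    q.eval (((s : ℚ) : ℝ) + z) = (q.shift s).eval z := by
  unfold QuadP.eval QuadP.shift; push_cast; ring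

/-- reflection of a quadratic: `q(c − z)`. [folklore] -/
def QuadP.reflect (q : QuadP) (c : ℚ) : QuadP :=
  ⟨q.v0 + q.v1 * (((c : ℚ) : ℝ) : ℂ) + q.v2 * (((c * c : ℚ) : ℝ) : ℂ),
   -(q.v1 + q.v2 * (((2 * c : ℚ) : ℝ) : ℂ)), q.v2⟩

/-- Soundness of `QuadP.reflect`. [folklore] -/
theorem QuadP.eval_reflect (q : QuadP) (c : ℚ) (z : ℝ) :
    q.eval (((c : ℚ) : ℝ) - z) = (q.reflect c).eval z := by
  unfold QuadP.eval QuadP.reflect; push_cast; ring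

/-- the linear polynomial `α + βz` as a quadratic. [folklore] -/
def linQ (α β : ℂ) : QuadP := ⟨α, β, 0⟩

/-- `(linQ α β).eval z = α + βz`. [folklore] -/
theorem linQ_eval (α β : ℂ) (z : ℝ) : (linQ α β).eval z = α + β * z := by
  unfold linQ QuadP.eval; ring

/-! ### The quadratics `𝔶𝔶₁ⱼ`, `𝔶𝔶₂ⱼ` -/

/-- `𝔶𝔶₁ⱼ` as a quadratic: `sπi(z − ½) + hπ²((0.504 − z)² − 2(0.502 − z)²)
= (−½sπi − 0.249992hπ²) + (sπi + hπ²)z − hπ²z²`. [folklore] -/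
def yy1Q (s h : ℚ) : QuadP :=
  ⟨(s : ℂ) * π * I * (((-1/2 : ℚ) : ℝ) : ℂ) + (h : ℂ) * ((π * π : ℝ) : ℂ) * (((-31249/125000 : ℚ) : ℝ) : ℂ),
   (s : ℂ) * π * I + (h : ℂ) * ((π * π : ℝ) : ℂ), -((h : ℂ) * ((π * π : ℝ) : ℂ))⟩

/-- `𝔶𝔶₂ⱼ` as a quadratic: `sπi(0.504 − z) + hπ²(0.504 − z)²
= (0.504sπi + 0.254016hπ²) + (−sπi − 1.008hπ²)z + hπ²z²`. [folklore] -/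
def yy2Q (s h : ℚ) : QuadP :=
  ⟨(s : ℂ) * π * I * (((63/125 : ℚ) : ℝ) : ℂ) + (h : ℂ) * ((π * π : ℝ) : ℂ) * (((3969/15625 : ℚ) : ℝ) : ℂ),
   -((s : ℂ) * π * I) + (h : ℂ) * ((π * π : ℝ) : ℂ) * (((-126/125 : ℚ) : ℝ) : ℂ), (h : ℂ) * ((π * π : ℝ) : ℂ)⟩

/-- `yy1F s h z = (yy1Q s h).eval z`. [folklore] -/
theorem yy1F_eq (s h : ℚ) (z : ℝ) : yy1F s h z = (yy1Q s h).eval z := by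
  unfold yy1F yy1Q QuadP.eval
  push_cast
  norm_num
  ring

/-- `yy2F s h z = (yy2Q s h).eval z`. [folklore] -/
theorem yy2F_eq (s h : ℚ) (z : ℝ) : yy2F s h z = (yy2Q s h).eval z := by
  unfold yy2F yy2Q QuadP.eval
  push_cast
  norm_num
  ring

/-! ### Exact integrals of cubic-exponentials -/

/-- `A₃ = wc₃`. [folklore] -/
def CubE.A3 (t : CubE) (w : ℂ) : ℂ := w * t.c3
/-- `A₂ = w(c₂ − 3A₃)`. [folklore] -/
def CubE.A2 (t : CubE) (w : ℂ) : ℂ := w * (t.c2 - t.A3 w * ((3 : ℤ) : ℂ))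
/-- `A₁ = w(c₁ − 2A₂)`. [folklore] -/
def CubE.A1 (t : CubE) (w : ℂ) : ℂ := w * (t.c1 - t.A2 w * ((2 : ℤ) : ℂ))
/-- `A₀ = w(c₀ − A₁)`. [folklore] -/
def CubE.A0 (t : CubE) (w : ℂ) : ℂ := w * (t.c0 - t.A1 w)

/-- the antiderivative polynomial `A₀ + A₁x + A₂x² + A₃x³` at a real point. [folklore] -/
def CubE.primAt (t : CubE) (w : ℂ) (x : ℝ) : ℂ :=
  t.A0 w + t.A1 w * x + t.A2 w * ((x * x : ℝ) : ℂ) + t.A3 w * ((x * x * x : ℝ) : ℂ)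

/-- the polynomial antiderivative `c₀x + c₁x²/2 + c₂x³/3 + c₃x⁴/4` (rate `0`). [folklore] -/
def CubE.polyPrimAt (t : CubE) (x : ℝ) : ℂ :=
  t.c0 * x + t.c1 * ((x * x : ℝ) : ℂ) * (((1/2 : ℚ) : ℝ) : ℂ)
    + t.c2 * ((x * x * x : ℝ) : ℂ) * (((1/3 : ℚ) : ℝ) : ℂ)
    + t.c3 * ((x * x * x * x : ℝ) : ℂ) * (((1/4 : ℚ) : ℝ) : ℂ)

/-- `w = 1/(mπi) = −i·(m⁻¹/π)`. [folklore] -/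
def wOf (m : ℚ) : ℂ := -(((overPi m⁻¹ : ℝ) : ℂ) * I)

/-- `mπi · w = 1`. [folklore] -/
theorem rate_mul_wOf {m : ℚ} (hm : m ≠ 0) : ((m : ℂ) * π * I) * wOf m = 1 := by
  unfold wOf
  have h := overPi_inv_mul hm
  linear_combination (-((m : ℂ) * π * (overPi m⁻¹ : ℝ))) * Complex.I_sq + h

/-- exact value of `∫_A^B (c₀ + c₁z + c₂z² + c₃z³)e^{mπiz} dz`. [folklore] -/
def CubE.integ (t : CubE) (m A B : ℚ) : ℂ :=
  if m = 0 then t.polyPrimAt B - t.polyPrimAt A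
  else t.primAt (wOf m) B * eIpi (m * B) - t.primAt (wOf m) A * eIpi (m * A)

/-- FTC for the exponential case. [folklore] -/
theorem CubE.integral_exp (t : CubE) {m : ℚ} (hm : m ≠ 0) (A B : ℝ) :
    ∫ z in A..B, t.eval m z
      = t.primAt (wOf m) B * cexp ((m : ℂ) * π * I * B)
        - t.primAt (wOf m) A * cexp ((m : ℂ) * π * I * A) := by
  have hcw := rate_mul_wOf hm
  generalize wOf m = w at hcw ⊢
  have hderiv : ∀ x : ℝ, HasDerivAt (fun y : ℝ => t.primAt w y * cexp ((m : ℂ) * π * I * y))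
      (t.eval m x) x := by
    intro x
    have h1 : HasDerivAt (fun y : ℝ => (y : ℂ)) 1 x := by
      simpa using (hasDerivAt_id x).ofReal_comp
    have hP : HasDerivAt (fun y : ℝ => t.primAt w y)
        (t.A1 w + t.A2 w * (2 * x) + t.A3 w * (3 * (x * x))) x := by
      have h := (((h1.const_mul (t.A1 w)).fun_add
        (((h1.fun_mul h1).const_mul (t.A2 w)).fun_add
          (((h1.fun_mul h1).fun_mul h1).const_mul (t.A3 w)))).const_add (t.A0 w))
      have e : (fun y : ℝ => t.primAt w y)
          = fun y : ℝ => t.A0 w + (t.A1 w * (y : ℂ)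
              + (t.A2 w * ((y : ℂ) * (y : ℂ)) + t.A3 w * ((y : ℂ) * (y : ℂ) * (y : ℂ)))) := by
        funext y; unfold CubE.primAt; push_cast; ring
      rw [e]
      exact h.congr_deriv (by ring)
    have hE : HasDerivAt (fun y : ℝ => cexp ((m : ℂ) * π * I * y))
        (cexp ((m : ℂ) * π * I * x) * ((m : ℂ) * π * I)) x :=
      ((h1.const_mul ((m : ℂ) * π * I)).cexp).congr_deriv (by ring)
    refine (hP.fun_mul hE).congr_deriv ?_
    unfold CubE.eval
    simp only [CubE.primAt, CubE.A0, CubE.A1, CubE.A2, CubE.A3]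
    push_cast
    linear_combination
      (cexp ((m : ℂ) * π * I * x) *
        ((t.c0 - w * (t.c1 - w * (t.c2 - w * t.c3 * 3) * 2))
          + (t.c1 - w * (t.c2 - w * t.c3 * 3) * 2) * x
          + (t.c2 - w * t.c3 * 3) * (x * x) + t.c3 * (x * x * x))) * hcw
  have hint : IntervalIntegrable (fun z : ℝ => t.eval m z) MeasureTheory.volume A B :=
    (Continuous.intervalIntegrable (by fun_prop) _ _)
  rw [intervalIntegral.integral_eq_sub_of_hasDerivAt (fun z _ => hderiv z) hint]

/-- FTC for the polynomial case (`m = 0`). [folklore] -/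
theorem CubE.integral_poly (t : CubE) (A B : ℝ) :
    ∫ z in A..B, t.eval 0 z = t.polyPrimAt B - t.polyPrimAt A := by
  have ev : ∀ z : ℝ, t.eval 0 z = t.c0 + t.c1 * z + t.c2 * (z * z) + t.c3 * (z * z * z) := by
    intro z; unfold CubE.eval; push_cast; simp
  have hderiv : ∀ x : ℝ, HasDerivAt (fun y : ℝ => t.polyPrimAt y)
      (t.c0 + t.c1 * x + t.c2 * (x * x) + t.c3 * (x * x * x)) x := by
    intro x
    have h1 : HasDerivAt (fun y : ℝ => (y : ℂ)) 1 x := by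
      simpa using (hasDerivAt_id x).ofReal_comp
    have h := (((h1.const_mul t.c0).fun_add
      ((((h1.fun_mul h1).const_mul t.c1).mul_const (1/2 : ℂ)).fun_add
        (((((h1.fun_mul h1).fun_mul h1).const_mul t.c2).mul_const (1/3 : ℂ)).fun_add
          (((((h1.fun_mul h1).fun_mul h1).fun_mul h1).const_mul t.c3).mul_const (1/4 : ℂ))))))
    have e : (fun y : ℝ => t.polyPrimAt y)
        = fun y : ℝ => t.c0 * (y : ℂ) + (t.c1 * ((y : ℂ) * (y : ℂ)) * (1/2 : ℂ)
            + (t.c2 * ((y : ℂ) * (y : ℂ) * (y : ℂ)) * (1/3 : ℂ)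
              + t.c3 * ((y : ℂ) * (y : ℂ) * (y : ℂ) * (y : ℂ)) * (1/4 : ℂ))) := by
      funext y; unfold CubE.polyPrimAt; push_cast; ring
    rw [e]
    exact h.congr_deriv (by ring)
  have hint : IntervalIntegrable (fun z : ℝ => t.eval 0 z) MeasureTheory.volume A B :=
    (Continuous.intervalIntegrable (by fun_prop) _ _)
  rw [intervalIntegral.integral_congr (fun z _ => ev z)] at *
  rw [intervalIntegral.integral_eq_sub_of_hasDerivAt (fun z _ => hderiv z)]
  exact (Continuous.intervalIntegrable (by fun_prop) _ _)

/-- **`∫_A^B t(z) dz = CubE.integ t m A B`** for rational endpoints. [folklore] -/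
theorem CubE.integral_eq (t : CubE) (m A B : ℚ) :
    ∫ z in ((A : ℚ) : ℝ)..((B : ℚ) : ℝ), t.eval m z = t.integ m A B := by
  unfold CubE.integ
  split_ifs with hm
  · subst hm; exact t.integral_poly _ _
  · rw [t.integral_exp hm]
    have eA : cexp ((m : ℂ) * π * I * (((A : ℚ) : ℝ) : ℂ)) = eIpi (m * A) := by
      unfold eIpi; congr 1; push_cast; ring
    have eB : cexp ((m : ℂ) * π * I * (((B : ℚ) : ℝ) : ℂ)) = eIpi (m * B) := by
      unfold eIpi; congr 1; push_cast; ring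
    rw [eA, eB]


/-- coefficientwise sum (same rate). [folklore] -/
def CubE.add (t1 t2 : CubE) : CubE := ⟨t1.c0 + t2.c0, t1.c1 + t2.c1, t1.c2 + t2.c2, t1.c3 + t2.c3⟩

/-- Soundness of `CubE.add`. [folklore] -/
theorem CubE.add_eval (t1 t2 : CubE) (m : ℚ) (z : ℝ) :
    t1.eval m z + t2.eval m z = (t1.add t2).eval m z := by
  unfold CubE.eval CubE.add; ring

/-- coefficientwise difference (same rate). [folklore] -/
def CubE.sub (t1 t2 : CubE) : CubE := ⟨t1.c0 - t2.c0, t1.c1 - t2.c1, t1.c2 - t2.c2, t1.c3 - t2.c3⟩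

/-- Soundness of `CubE.sub`. [folklore] -/
theorem CubE.sub_eval (t1 t2 : CubE) (m : ℚ) (z : ℝ) :
    t1.eval m z - t2.eval m z = (t1.sub t2).eval m z := by
  unfold CubE.eval CubE.sub; ring

/-- `c + q(z)`. [folklore] -/
def QuadP.constAdd (c : ℂ) (q : QuadP) : QuadP := ⟨c + q.v0, q.v1, q.v2⟩

/-- Soundness of `QuadP.constAdd`. [folklore] -/
theorem QuadP.constAdd_eval (c : ℂ) (q : QuadP) (z : ℝ) :
    c + q.eval z = (QuadP.constAdd c q).eval z := by
  unfold QuadP.eval QuadP.constAdd; ring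

/-- `∫_0^B t = integ t m 0 B`. [folklore] -/
theorem CubE.integral_eq0 (t : CubE) (m B : ℚ) :
    ∫ z in (0:ℝ)..((B : ℚ) : ℝ), t.eval m z = t.integ m 0 B := by
  simpa using t.integral_eq m 0 B

/-- `∫_A^B (t₁ + t₂)` for two rates. [folklore] -/
theorem CubE.integral_add_eq (t1 t2 : CubE) (m1 m2 A B : ℚ) :
    ∫ z in ((A : ℚ) : ℝ)..((B : ℚ) : ℝ), (t1.eval m1 z + t2.eval m2 z)
      = t1.integ m1 A B + t2.integ m2 A B := by
  rw [intervalIntegral.integral_add ((t1.continuous_eval m1).intervalIntegrable _ _)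
    ((t2.continuous_eval m2).intervalIntegrable _ _), CubE.integral_eq, CubE.integral_eq]

/-- `∫_0^B (t₁ + t₂)` for two rates. [folklore] -/
theorem CubE.integral_add_eq0 (t1 t2 : CubE) (m1 m2 B : ℚ) :
    ∫ z in (0:ℝ)..((B : ℚ) : ℝ), (t1.eval m1 z + t2.eval m2 z)
      = t1.integ m1 0 B + t2.integ m2 0 B := by
  simpa using CubE.integral_add_eq t1 t2 m1 m2 0 B

/-! ### Literal conversions (decimals of the manuscript ↦ rationals; prefactors ↦ engine shapes) -/

/-- `0.002 = 1/500`. [folklore] -/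
theorem dR0002 : (0.002 : ℝ) = ((1/500 : ℚ) : ℝ) := by norm_num
/-- `0.004 = 1/250`. [folklore] -/
theorem dR0004 : (0.004 : ℝ) = ((1/250 : ℚ) : ℝ) := by norm_num
/-- `0.5 = 1/2`. [folklore] -/
theorem dR05 : (0.5 : ℝ) = ((1/2 : ℚ) : ℝ) := by norm_num
/-- `0.502 = 251/500`. [folklore] -/
theorem dR0502 : (0.502 : ℝ) = ((251/500 : ℚ) : ℝ) := by norm_num
/-- `0.504 = 63/125`. [folklore] -/
theorem dR0504 : (0.504 : ℝ) = ((63/125 : ℚ) : ℝ) := by norm_num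
/-- `0.496 = 62/125`. [folklore] -/
theorem dR0496 : (0.496 : ℝ) = ((62/125 : ℚ) : ℝ) := by norm_num
/-- `0.5 = 1/2` in `ℂ`. [folklore] -/
theorem dC05 : (0.5 : ℂ) = (((1/2 : ℚ) : ℝ) : ℂ) := by norm_num
/-- `0.504 = 63/125` in `ℂ`. [folklore] -/
theorem dC0504 : (0.504 : ℂ) = (((63/125 : ℚ) : ℝ) : ℂ) := by norm_num
/-- `0.498 = 249/500` in `ℂ`. [folklore] -/
theorem dC0498 : (0.498 : ℂ) = (((249/500 : ℚ) : ℝ) : ℂ) := by norm_num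

/-- `1/0.504 = 125/63`. [folklore] -/
theorem sc_inv504 : ((1 / 0.504 : ℝ) : ℂ) = (((125/63 : ℚ) : ℝ) : ℂ) := by
  rw [show (1 / 0.504 : ℝ) = ((125/63 : ℚ) : ℝ) by norm_num]

/-- `ι₂/0.5 = 2ι₂`. [folklore] -/
theorem sc_iota2 : iota2 / (0.5 : ℂ) = iota2 * (((2 : ℚ) : ℝ) : ℂ) := by
  rw [show (((2 : ℚ) : ℝ) : ℂ) = (0.5 : ℂ)⁻¹ by norm_num, div_eq_mul_inv]

/-- `500/(0.504π) = (62500/63)/π`. [folklore] -/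
theorem sc_504pi : ((500 / (0.504 * π) : ℝ) : ℂ) = ((overPi (62500/63) : ℝ) : ℂ) := by
  congr 1; unfold overPi; rw [div_mul_eq_div_div]; congr 1; norm_num

/-- `500²/π = 250000/π`. [folklore] -/
theorem sc_sqpi : ((500 ^ 2 / π : ℝ) : ℂ) = ((overPi 250000 : ℝ) : ℂ) := by
  congr 1; unfold overPi; norm_num

/-- `500ι/(0.498π) = ι · (250000/249)/π`. [folklore] -/
theorem sc_498pi (w : ℂ) : 500 * w / (((0.498 * π : ℝ)) : ℂ) = w * ((overPi (250000/249) : ℝ) : ℂ) := by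
  have hπ : (π : ℂ) ≠ 0 := Complex.ofReal_ne_zero.mpr Real.pi_ne_zero
  rw [show (0.498 : ℝ) = ((249/500 : ℚ) : ℝ) by norm_num]
  unfold overPi; push_cast
  field_simp
  ring

/-- `1000ι/π = ι · 1000/π`. [folklore] -/
theorem sc_1000pi (w : ℂ) : 1000 * w / (π : ℂ) = w * ((overPi 1000 : ℝ) : ℂ) := by
  have hπ : (π : ℂ) ≠ 0 := Complex.ofReal_ne_zero.mpr Real.pi_ne_zero
  unfold overPi; push_cast
  field_simp

/-- `500/π`. [folklore] -/
theorem sc_500pi : 500 / (π : ℂ) = ((overPi 500 : ℝ) : ℂ) := by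
  unfold overPi; push_cast; norm_num

/-- `500ij/0.504 = (62500j/63)i`. [folklore] -/
theorem sc_j504 (j : ℕ) : 500 * I * (j : ℂ) / 0.504 = ((((j : ℚ) * (62500/63) : ℚ) : ℝ) : ℂ) * I := by
  rw [show (0.504 : ℂ) = 63/125 by norm_num]; push_cast; ring

/-- `500ijι₃/0.498 = (250000j/249)iι₃`. [folklore] -/
theorem sc_j498 (j : ℕ) :
    500 * I * (j : ℂ) * iota3 / 0.498 = ((((j : ℚ) * (250000/249) : ℚ) : ℝ) : ℂ) * I * iota3 := by
  rw [show (0.498 : ℂ) = 249/500 by norm_num]; push_cast; ring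

/-- `1000ijι₄`. [folklore] -/
theorem sc_j1000 (j : ℕ) :
    1000 * I * (j : ℂ) * iota4 = ((((j : ℚ) * 1000 : ℚ) : ℝ) : ℂ) * I * iota4 := by
  push_cast; ring

/-- `nπ/500`. [folklore] -/
theorem sc_n500 (n : ℕ) : ((n * π / 500 : ℝ) : ℂ) = (((((n : ℚ) / 500 : ℚ) : ℝ) * π : ℝ) : ℂ) := by
  push_cast; ring

/-! ### Closed forms of the §10 / (2.33) constants -/

/-- `0.002 − z` as a quadratic record. [folklore] -/
def linH : QuadP := linQ ((((1/500 : ℚ) : ℝ)) : ℂ) (-1)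

/-- `z` as a quadratic record. [folklore] -/
def linZ : QuadP := linQ 0 1

/-- Closed form of `d₃ⱼ` (generic in `n = 11 − 6j + j²`, the `a`-parameters of `𝔣𝔣ⱼ₆, 𝔣𝔣ⱼ₇` and
the `(s, h)` of `𝔶𝔶`). [cite: Zhang2022LandauSiegel, §10 before (10.12)] -/
def d3val (n a6 a7 s hh : ℚ) : ℂ :=
  -((((n / 500 : ℚ) : ℝ) * π : ℝ) : ℂ) *
      ((((ffLin a6).shift (3/2) (1/250)).toCubE.smul (((125/63 : ℚ) : ℝ) : ℂ)).integ (3/2) 0 (1/2)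
        + ((ffLin a7).toCubE.smul (iota2 * (((2 : ℚ) : ℝ) : ℂ))).integ (5/2) 0 (1/2))
    + ((overPi (62500/63) : ℝ) : ℂ) *
      ((ffLin a6).toCubE.sub ((ffLin a6).shift (3/2) (1/500)).toCubE).integ (3/2) 0 (1/500)
    + ((overPi (62500/63) : ℝ) : ℂ) *
      ((((ffLin a6).reflect (3/2) (63/125)).mulQ (yy1Q s hh)).integ (-(3/2)) (1/2) (251/500)
        + (((ffLin a6).reflect (3/2) (63/125)).mulQ (yy2Q s hh)).integ (-(3/2)) (251/500) (63/125))

/-- **`d₃ⱼ` in closed form.** [cite: Zhang2022LandauSiegel, §10 before (10.12)] -/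
theorem d3F_eq (n : ℕ) (a6 a7 s hh : ℚ) :
    d3F n (ffF a6 (3/2)) (ffF a7 (5/2)) (yy1F s hh) (yy2F s hh) = d3val n a6 a7 s hh := by
  have p1 : ∀ z : ℝ, (((125/63 : ℚ) : ℝ) : ℂ) * ffF a6 (3/2) (((1/250 : ℚ) : ℝ) + z)
        + iota2 * (((2 : ℚ) : ℝ) : ℂ) * ffF a7 (5/2) z
      = (((ffLin a6).shift (3/2) (1/250)).toCubE.smul (((125/63 : ℚ) : ℝ) : ℂ)).eval (3/2) z
        + ((ffLin a7).toCubE.smul (iota2 * (((2 : ℚ) : ℝ) : ℂ))).eval (5/2) z := by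
    intro z
    simp only [ffF_eq_eval]
    simp only [LinE.eval_shift]
    simp only [LinE.eval, CubE.eval, LinE.toCubE, CubE.smul]
    push_cast; ring
  have p2 : ∀ z : ℝ, ffF a6 (3/2) z - ffF a6 (3/2) (((1/500 : ℚ) : ℝ) + z)
      = ((ffLin a6).toCubE.sub ((ffLin a6).shift (3/2) (1/500)).toCubE).eval (3/2) z := by
    intro z
    simp only [ffF_eq_eval]
    simp only [LinE.eval_shift]
    simp only [LinE.eval, CubE.eval, LinE.toCubE, CubE.sub]
    push_cast; ring
  have p3 : ∀ z : ℝ, ffF a6 (3/2) (((63/125 : ℚ) : ℝ) - z) * yy1F s hh z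
      = (((ffLin a6).reflect (3/2) (63/125)).mulQ (yy1Q s hh)).eval (-(3/2)) z := by
    intro z
    simp only [ffF_eq_eval, yy1F_eq]
    simp only [LinE.eval_reflect]
    simp only [LinE.eval, QuadP.eval, CubE.eval, LinE.mulQ]
    push_cast; ring
  have p4 : ∀ z : ℝ, ffF a6 (3/2) (((63/125 : ℚ) : ℝ) - z) * yy2F s hh z
      = (((ffLin a6).reflect (3/2) (63/125)).mulQ (yy2Q s hh)).eval (-(3/2)) z := by
    intro z
    simp only [ffF_eq_eval, yy2F_eq]
    simp only [LinE.eval_reflect]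
    simp only [LinE.eval, QuadP.eval, CubE.eval, LinE.mulQ]
    push_cast; ring
  unfold d3F d3val
  simp only [sc_inv504, sc_iota2, sc_504pi, sc_n500]
  simp only [dR0004, dR05, dR0002, dR0502, dR0504]
  rw [intervalIntegral.integral_congr (fun z _ => p1 z),
    intervalIntegral.integral_congr (fun z _ => p2 z),
    intervalIntegral.integral_congr (fun z _ => p3 z),
    intervalIntegral.integral_congr (fun z _ => p4 z)]
  rw [CubE.integral_add_eq0, CubE.integral_eq0, CubE.integral_eq, CubE.integral_eq]

/-- Closed form of `d₄ⱼ` (generic in `j` and the parameters `(r₀, r₁, b)` of `𝔤𝔥ⱼ₆`).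
[cite: Zhang2022LandauSiegel, §10 before (10.13)] -/
def d4val (j r0 r1 b : ℚ) : ℂ :=
  ((overPi (62500/63) : ℝ) : ℂ) *
      (((gh0Lin r0).toCubE.sub ((gh0Lin r0).shift 0 (1/500)).toCubE).integ 0 0 (1/500)
        + ((gh1Lin r1 b).toCubE.sub ((gh1Lin r1 b).shift (-(3/2)) (1/500)).toCubE).integ
            (-(3/2)) 0 (1/500))
    - (((j * (62500/63) : ℚ) : ℝ) : ℂ) * I *
      (((((gh0Lin r0).shift 0 (1/500)).mulQ linH).add ((gh0Lin r0).mulQ linZ)).integ 0 0 (1/500)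
        + ((((gh1Lin r1 b).shift (-(3/2)) (1/500)).mulQ linH).add ((gh1Lin r1 b).mulQ linZ)).integ
            (-(3/2)) 0 (1/500))

/-- **`d₄ⱼ` in closed form.** [cite: Zhang2022LandauSiegel, §10 before (10.13)] -/
theorem d4F_eq (j : ℕ) (r0 r1 b : ℚ) : d4F j (ghF r0 r1 b (3/2)) = d4val j r0 r1 b := by
  have p1 : ∀ z : ℝ, ghF r0 r1 b (3/2) z - ghF r0 r1 b (3/2) (((1/500 : ℚ) : ℝ) + z)
      = ((gh0Lin r0).toCubE.sub ((gh0Lin r0).shift 0 (1/500)).toCubE).eval 0 z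
        + ((gh1Lin r1 b).toCubE.sub ((gh1Lin r1 b).shift (-(3/2)) (1/500)).toCubE).eval
            (-(3/2)) z := by
    intro z
    simp only [ghF_eq_eval]
    simp only [LinE.eval_shift]
    simp only [LinE.eval, CubE.eval, LinE.toCubE, CubE.sub]
    push_cast; ring
  have p2 : ∀ z : ℝ, ghF r0 r1 b (3/2) (((1/500 : ℚ) : ℝ) + z) * (((((1/500 : ℚ) : ℝ) - z : ℝ)) : ℂ)
        + ghF r0 r1 b (3/2) z * (z : ℂ)
      = ((((gh0Lin r0).shift 0 (1/500)).mulQ linH).add ((gh0Lin r0).mulQ linZ)).eval 0 z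
        + ((((gh1Lin r1 b).shift (-(3/2)) (1/500)).mulQ linH).add ((gh1Lin r1 b).mulQ linZ)).eval
            (-(3/2)) z := by
    intro z
    simp only [ghF_eq_eval]
    simp only [LinE.eval_shift]
    simp only [LinE.eval, CubE.eval, LinE.mulQ, CubE.add, linH, linZ, linQ]
    push_cast; ring
  unfold d4F d4val
  simp only [sc_504pi, sc_j504]
  simp only [dR0002]
  rw [intervalIntegral.integral_congr (fun z _ => p1 z),
    intervalIntegral.integral_congr (fun z _ => p2 z)]
  rw [CubE.integral_add_eq0, CubE.integral_add_eq0]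

/-- Closed form of `d′₅ⱼ`. [cite: Zhang2022LandauSiegel, §10 before (10.14)] -/
def d5pval (r0 r1 b : ℚ) : ℂ :=
  -(iota3 * ((overPi (250000/249) : ℝ) : ℂ)) *
    ((gh0Lin r0).toCubE.integ 0 0 (1/500) + (gh1Lin r1 b).toCubE.integ (-(3/2)) 0 (1/500))

/-- **`d′₅ⱼ` in closed form.** [cite: Zhang2022LandauSiegel, §10 before (10.14)] -/
theorem d5pF_eq (r0 r1 b : ℚ) : d5pF (ghF r0 r1 b (3/2)) = d5pval r0 r1 b := by
  have p1 : ∀ z : ℝ, ghF r0 r1 b (3/2) z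
      = (gh0Lin r0).toCubE.eval 0 z + (gh1Lin r1 b).toCubE.eval (-(3/2)) z := by
    intro z
    simp only [ghF_eq_eval]
    simp only [LinE.eval, CubE.eval, LinE.toCubE]
    push_cast; ring
  unfold d5pF d5pval
  simp only [sc_498pi]
  simp only [dR0002]
  rw [intervalIntegral.integral_congr (fun z _ => p1 z)]
  rw [CubE.integral_add_eq0]

/-- Closed form of `d₅ⱼ` (generic in `j`, the parameters `(r₀, r₁, b)` of `𝔤𝔥ⱼ₆` and `(r₀′, r₁′, b′)`
of `𝔤𝔥ⱼ₇`). [cite: Zhang2022LandauSiegel, §10 before (10.14)] -/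
def d5val (j r0 r1 b r0' r1' b' : ℚ) : ℂ :=
  iota4 * ((overPi 1000 : ℝ) : ℂ) *
      (((gh0Lin r0').toCubE.sub ((gh0Lin r0').shift 0 (1/500)).toCubE).integ 0 0 (1/500)
        + ((gh1Lin r1' b').toCubE.sub ((gh1Lin r1' b').shift (-(5/2)) (1/500)).toCubE).integ
            (-(5/2)) 0 (1/500))
    - (((j * (250000/249) : ℚ) : ℝ) : ℂ) * I * iota3 *
      (((gh0Lin r0).mulQ linH).integ 0 0 (1/500) + ((gh1Lin r1 b).mulQ linH).integ (-(3/2)) 0 (1/500))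
    - (((j * 1000 : ℚ) : ℝ) : ℂ) * I * iota4 *
      (((((gh0Lin r0').shift 0 (1/500)).mulQ linH).add ((gh0Lin r0').mulQ linZ)).integ 0 0 (1/500)
        + ((((gh1Lin r1' b').shift (-(5/2)) (1/500)).mulQ linH).add ((gh1Lin r1' b').mulQ linZ)).integ
            (-(5/2)) 0 (1/500))

/-- **`d₅ⱼ` in closed form.** [cite: Zhang2022LandauSiegel, §10 before (10.14)] -/
theorem d5F_eq (j : ℕ) (r0 r1 b r0' r1' b' : ℚ) :
    d5F j (ghF r0 r1 b (3/2)) (ghF r0' r1' b' (5/2)) = d5val j r0 r1 b r0' r1' b' := by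
  have p1 : ∀ z : ℝ, ghF r0' r1' b' (5/2) z - ghF r0' r1' b' (5/2) (((1/500 : ℚ) : ℝ) + z)
      = ((gh0Lin r0').toCubE.sub ((gh0Lin r0').shift 0 (1/500)).toCubE).eval 0 z
        + ((gh1Lin r1' b').toCubE.sub ((gh1Lin r1' b').shift (-(5/2)) (1/500)).toCubE).eval
            (-(5/2)) z := by
    intro z
    simp only [ghF_eq_eval]
    simp only [LinE.eval_shift]
    simp only [LinE.eval, CubE.eval, LinE.toCubE, CubE.sub]
    push_cast; ring
  have p2 : ∀ z : ℝ, (((((1/500 : ℚ) : ℝ) - z : ℝ)) : ℂ) * ghF r0 r1 b (3/2) z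
      = ((gh0Lin r0).mulQ linH).eval 0 z + ((gh1Lin r1 b).mulQ linH).eval (-(3/2)) z := by
    intro z
    simp only [ghF_eq_eval]
    simp only [LinE.eval, CubE.eval, LinE.mulQ, linH, linQ]
    push_cast; ring
  have p3 : ∀ z : ℝ, (((((1/500 : ℚ) : ℝ) - z : ℝ)) : ℂ) * ghF r0' r1' b' (5/2) (((1/500 : ℚ) : ℝ) + z)
        + (z : ℂ) * ghF r0' r1' b' (5/2) z
      = ((((gh0Lin r0').shift 0 (1/500)).mulQ linH).add ((gh0Lin r0').mulQ linZ)).eval 0 z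
        + ((((gh1Lin r1' b').shift (-(5/2)) (1/500)).mulQ linH).add ((gh1Lin r1' b').mulQ linZ)).eval
            (-(5/2)) z := by
    intro z
    simp only [ghF_eq_eval]
    simp only [LinE.eval_shift]
    simp only [LinE.eval, CubE.eval, LinE.mulQ, CubE.add, linH, linZ, linQ]
    push_cast; ring
  unfold d5F d5val
  simp only [sc_1000pi, sc_j498, sc_j1000]
  simp only [dR0002]
  rw [intervalIntegral.integral_congr (fun z _ => p1 z),
    intervalIntegral.integral_congr (fun z _ => p2 z),
    intervalIntegral.integral_congr (fun z _ => p3 z)]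
  rw [CubE.integral_add_eq0, CubE.integral_add_eq0, CubE.integral_add_eq0]

/-- Closed form of `d′₆ⱼ`. [cite: Zhang2022LandauSiegel, (10.15)] -/
def d6pval (a6 : ℚ) : ℂ :=
  -(conj iota3 * ((overPi (250000/249) : ℝ) : ℂ)) * (ffLin a6).toCubE.integ (3/2) 0 (1/500)

/-- **`d′₆ⱼ` in closed form.** [cite: Zhang2022LandauSiegel, (10.15)] -/
theorem d6pF_eq (a6 : ℚ) : d6pF (ffF a6 (3/2)) = d6pval a6 := by
  have p1 : ∀ z : ℝ, ffF a6 (3/2) z = (ffLin a6).toCubE.eval (3/2) z := by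
    intro z
    simp only [ffF_eq_eval]
    simp only [LinE.eval, CubE.eval, LinE.toCubE]
    push_cast; ring
  unfold d6pF d6pval
  simp only [sc_498pi]
  simp only [dR0002]
  rw [intervalIntegral.integral_congr (fun z _ => p1 z)]
  rw [CubE.integral_eq0]

/-- Closed form of `d₆ⱼ` (generic in `n = 11 − 6j + j²`, the `a`-parameters of `𝔣𝔣ⱼ₆, 𝔣𝔣ⱼ₇` and
`(s, h)` of `𝔶𝔶`). [cite: Zhang2022LandauSiegel, §10 after (10.15)] -/
def d6val (n a6 a7 s hh : ℚ) : ℂ :=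
  -((((n / 500 : ℚ) : ℝ) * π : ℝ) : ℂ) *
      ((((ffLin a6).shift (3/2) (1/500)).toCubE.smul (conj iota3 * (((500/249 : ℚ) : ℝ) : ℂ))).integ
          (3/2) 0 (62/125)
        + (((ffLin a7).shift (5/2) (1/250)).toCubE.smul (conj iota4 * (((2 : ℚ) : ℝ) : ℂ))).integ
          (5/2) 0 (62/125))
    + conj iota4 * ((overPi 1000 : ℝ) : ℂ) *
      ((ffLin a7).toCubE.sub ((ffLin a7).shift (5/2) (1/500)).toCubE).integ (5/2) 0 (1/500)
    + ((overPi 500 : ℝ) : ℂ) *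
      ((((ffLin a6).mulQ ((yy1Q s hh).reflect (251/500))).smul
            (conj iota3 * (((500/249 : ℚ) : ℝ) : ℂ))).integ (3/2) 0 (1/500)
        + ((((ffLin a7).shift (5/2) (1/500)).mulQ ((yy1Q s hh).reflect (251/500))).smul
            (conj iota4 * (((2 : ℚ) : ℝ) : ℂ))).integ (5/2) 0 (1/500))
    + conj iota4 * ((overPi 1000 : ℝ) : ℂ) *
      (((ffLin a7).mulQ ((yy2Q s hh).reflect (63/125))).integ (5/2) 0 (1/500))

/-- **`d₆ⱼ` in closed form.** [cite: Zhang2022LandauSiegel, §10 after (10.15)] -/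
theorem d6F_eq (n : ℕ) (a6 a7 s hh : ℚ) :
    d6F n (ffF a6 (3/2)) (ffF a7 (5/2)) (yy1F s hh) (yy2F s hh) = d6val n a6 a7 s hh := by
  have p1 : ∀ z : ℝ, conj iota3 * ffF a6 (3/2) (((1/500 : ℚ) : ℝ) + z) / (((249/500 : ℚ) : ℝ) : ℂ)
        + conj iota4 * ffF a7 (5/2) (((1/250 : ℚ) : ℝ) + z) / (((1/2 : ℚ) : ℝ) : ℂ)
      = (((ffLin a6).shift (3/2) (1/500)).toCubE.smul (conj iota3 * (((500/249 : ℚ) : ℝ) : ℂ))).eval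
          (3/2) z
        + (((ffLin a7).shift (5/2) (1/250)).toCubE.smul (conj iota4 * (((2 : ℚ) : ℝ) : ℂ))).eval
          (5/2) z := by
    intro z
    simp only [ffF_eq_eval]
    simp only [LinE.eval_shift]
    simp only [LinE.eval, CubE.eval, LinE.toCubE, CubE.smul]
    push_cast; ring
  have p2 : ∀ z : ℝ, ffF a7 (5/2) z - ffF a7 (5/2) (((1/500 : ℚ) : ℝ) + z)
      = ((ffLin a7).toCubE.sub ((ffLin a7).shift (5/2) (1/500)).toCubE).eval (5/2) z := by
    intro z
    simp only [ffF_eq_eval]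
    simp only [LinE.eval_shift]
    simp only [LinE.eval, CubE.eval, LinE.toCubE, CubE.sub]
    push_cast; ring
  have p3 : ∀ z : ℝ, (conj iota3 * ffF a6 (3/2) z / (((249/500 : ℚ) : ℝ) : ℂ)
        + conj iota4 * ffF a7 (5/2) (((1/500 : ℚ) : ℝ) + z) / (((1/2 : ℚ) : ℝ) : ℂ))
        * yy1F s hh (((251/500 : ℚ) : ℝ) - z)
      = (((ffLin a6).mulQ ((yy1Q s hh).reflect (251/500))).smul
            (conj iota3 * (((500/249 : ℚ) : ℝ) : ℂ))).eval (3/2) z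
        + ((((ffLin a7).shift (5/2) (1/500)).mulQ ((yy1Q s hh).reflect (251/500))).smul
            (conj iota4 * (((2 : ℚ) : ℝ) : ℂ))).eval (5/2) z := by
    intro z
    simp only [ffF_eq_eval, yy1F_eq]
    simp only [LinE.eval_shift, QuadP.eval_reflect]
    simp only [LinE.eval, QuadP.eval, CubE.eval, LinE.mulQ, CubE.smul]
    push_cast; ring
  have p4 : ∀ z : ℝ, ffF a7 (5/2) z * yy2F s hh (((63/125 : ℚ) : ℝ) - z)
      = ((ffLin a7).mulQ ((yy2Q s hh).reflect (63/125))).eval (5/2) z := by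
    intro z
    simp only [ffF_eq_eval, yy2F_eq]
    simp only [QuadP.eval_reflect]
    simp only [LinE.eval, QuadP.eval, CubE.eval, LinE.mulQ]
    push_cast; ring
  unfold d6F d6val
  simp only [sc_1000pi, sc_500pi, sc_n500]
  simp only [dR0002, dR0004, dR0502, dR0504, dR0496, dC05, dC0498]
  rw [intervalIntegral.integral_congr (fun z _ => p1 z),
    intervalIntegral.integral_congr (fun z _ => p2 z),
    intervalIntegral.integral_congr (fun z _ => p3 z),
    intervalIntegral.integral_congr (fun z _ => p4 z)]
  rw [CubE.integral_add_eq0, CubE.integral_eq0, CubE.integral_add_eq0, CubE.integral_eq0]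

/-- the linear factor `−1 − jπi(z − ½) = (−1 + ½jπi) − jπi·z` (rate `0`). [folklore] -/
def d7lin1 (j : ℚ) : LinE := ⟨-1 + (j : ℂ) * π * I * (((1/2 : ℚ) : ℝ) : ℂ), -((j : ℂ) * π * I)⟩

/-- the linear factor `1 − jπi(0.504 − z) = (1 − 0.504jπi) + jπi·z` (rate `0`). [folklore] -/
def d7lin2 (j : ℚ) : LinE := ⟨1 - (j : ℂ) * π * I * (((63/125 : ℚ) : ℝ) : ℂ), (j : ℂ) * π * I⟩

/-- Closed form of `d₇ⱼ` (generic in `j` and the `(s, h)` of `𝔶𝔶₁ⱼ` and of `𝔶𝔶₂ⱼ` separately, so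
that the verbatim reading `d7litF` is covered). [cite: Zhang2022LandauSiegel, §18 proof of (2.33)] -/
def d7val (j s1 h1 s2 h2 : ℚ) (second : ℚ → ℚ → QuadP) : ℂ :=
  ((overPi 250000 : ℝ) : ℂ) *
    (((d7lin1 j).mulQ (QuadP.constAdd (-1) (yy1Q s1 h1))).integ 0 (1/2) (251/500)
      + ((d7lin2 j).mulQ (QuadP.constAdd 1 (second s2 h2))).integ 0 (251/500) (63/125))

/-- **`d₇ⱼ` in closed form** (`𝔶𝔶₂ⱼ` reading). [cite: Zhang2022LandauSiegel, §18 proof of (2.33)] -/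
theorem d7F_eq (j : ℕ) (s hh : ℚ) :
    d7F j (yy1F s hh) (yy2F s hh) = d7val j s hh s hh yy2Q := by
  have p1 : ∀ z : ℝ, (-1 - (j : ℂ) * π * I * ((z : ℂ) - (((1/2 : ℚ) : ℝ) : ℂ))) * (-1 + yy1F s hh z)
      = ((d7lin1 j).mulQ (QuadP.constAdd (-1) (yy1Q s hh))).eval 0 z := by
    intro z
    simp only [yy1F_eq]
    simp only [QuadP.eval, CubE.eval, LinE.mulQ, QuadP.constAdd, d7lin1]
    push_cast
    simp only [zero_mul, Complex.exp_zero, mul_one]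
    ring
  have p2 : ∀ z : ℝ, (1 - (j : ℂ) * π * I * ((((63/125 : ℚ) : ℝ) : ℂ) - (z : ℂ))) * (1 + yy2F s hh z)
      = ((d7lin2 j).mulQ (QuadP.constAdd 1 (yy2Q s hh))).eval 0 z := by
    intro z
    simp only [yy2F_eq]
    simp only [QuadP.eval, CubE.eval, LinE.mulQ, QuadP.constAdd, d7lin2]
    push_cast
    simp only [zero_mul, Complex.exp_zero, mul_one]
    ring
  unfold d7F d7val
  simp only [sc_sqpi]
  simp only [dR05, dR0502, dR0504, dC05, dC0504]
  rw [intervalIntegral.integral_congr (fun z _ => p1 z),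
    intervalIntegral.integral_congr (fun z _ => p2 z)]
  rw [CubE.integral_eq, CubE.integral_eq]

/-- **`d₇ⱼ` in closed form**, verbatim reading (`𝔶𝔶₁ⱼ` in both ranges).
[cite: Zhang2022LandauSiegel, §18 proof of (2.33)] -/
theorem d7litF_eq (j : ℕ) (s hh : ℚ) :
    d7litF j (yy1F s hh) = d7val j s hh s hh yy1Q := by
  have p1 : ∀ z : ℝ, (-1 - (j : ℂ) * π * I * ((z : ℂ) - (((1/2 : ℚ) : ℝ) : ℂ))) * (-1 + yy1F s hh z)
      = ((d7lin1 j).mulQ (QuadP.constAdd (-1) (yy1Q s hh))).eval 0 z := by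
    intro z
    simp only [yy1F_eq]
    simp only [QuadP.eval, CubE.eval, LinE.mulQ, QuadP.constAdd, d7lin1]
    push_cast
    simp only [zero_mul, Complex.exp_zero, mul_one]
    ring
  have p2 : ∀ z : ℝ, (1 - (j : ℂ) * π * I * ((((63/125 : ℚ) : ℝ) : ℂ) - (z : ℂ))) * (1 + yy1F s hh z)
      = ((d7lin2 j).mulQ (QuadP.constAdd 1 (yy1Q s hh))).eval 0 z := by
    intro z
    simp only [yy1F_eq]
    simp only [QuadP.eval, CubE.eval, LinE.mulQ, QuadP.constAdd, d7lin2]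
    push_cast
    simp only [zero_mul, Complex.exp_zero, mul_one]
    ring
  unfold d7litF d7F d7val
  simp only [sc_sqpi]
  simp only [dR05, dR0502, dR0504, dC05, dC0504]
  rw [intervalIntegral.integral_congr (fun z _ => p1 z),
    intervalIntegral.integral_congr (fun z _ => p2 z)]
  rw [CubE.integral_eq, CubE.integral_eq]

/-! ### The named constants -/

/-- `d₃₁ = d3val 6 (1/2) (3/2) 5 (−3)`. [cite: Zhang2022LandauSiegel, §10 before (10.12)] -/
theorem d31_eq : d31 = d3val 6 (1/2) (3/2) 5 (-3) := by
  unfold d31 ff16 ff17 yy11 yy21; exact_mod_cast d3F_eq 6 (1/2) (3/2) 5 (-3)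
/-- `d₃₂`. [cite: Zhang2022LandauSiegel, §10 before (10.12)] -/
theorem d32_eq : d32 = d3val 3 (-1/2) (1/2) 4 (-3/2) := by
  unfold d32 ff26 ff27 yy12 yy22; exact_mod_cast d3F_eq 3 (-1/2) (1/2) 4 (-3/2)
/-- `d₃₃`. [cite: Zhang2022LandauSiegel, §10 before (10.12)] -/
theorem d33_eq : d33 = d3val 2 (-3/2) (-1/2) 3 (-1) := by
  unfold d33 ff36 ff37 yy13 yy23; exact_mod_cast d3F_eq 2 (-3/2) (-1/2) 3 (-1)

/-- `d₄₁`. [cite: Zhang2022LandauSiegel, §10 before (10.13)] -/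
theorem d41_eq : d41 = d4val 1 (8/3) (-5/3) (-1/2) := by
  unfold d41 gh16; exact_mod_cast d4F_eq 1 (8/3) (-5/3) (-1/2)
/-- `d₄₂`. [cite: Zhang2022LandauSiegel, §10 before (10.13)] -/
theorem d42_eq : d42 = d4val 2 (4/3) (-1/3) (1/2) := by
  unfold d42 gh26; exact_mod_cast d4F_eq 2 (4/3) (-1/3) (1/2)
/-- `d₄₃`. [cite: Zhang2022LandauSiegel, §10 before (10.13)] -/
theorem d43_eq : d43 = d4val 3 (8/9) (1/9) (1/6) := by
  unfold d43 gh36; exact_mod_cast d4F_eq 3 (8/9) (1/9) (1/6)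

/-- `d′₅₁`. [cite: Zhang2022LandauSiegel, §10 before (10.14)] -/
theorem d5p1_eq : d5p1 = d5pval (8/3) (-5/3) (-1/2) := by unfold d5p1 gh16; exact d5pF_eq _ _ _
/-- `d′₅₂`. [cite: Zhang2022LandauSiegel, §10 before (10.14)] -/
theorem d5p2_eq : d5p2 = d5pval (4/3) (-1/3) (1/2) := by unfold d5p2 gh26; exact d5pF_eq _ _ _
/-- `d′₅₃`. [cite: Zhang2022LandauSiegel, §10 before (10.14)] -/
theorem d5p3_eq : d5p3 = d5pval (8/9) (1/9) (1/6) := by unfold d5p3 gh36; exact d5pF_eq _ _ _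

/-- `d₅₁`. [cite: Zhang2022LandauSiegel, §10 before (10.14)] -/
theorem d51_eq : d51 = d5val 1 (8/3) (-5/3) (-1/2) (24/25) (1/25) (1/10) := by
  unfold d51 gh16 gh17; exact_mod_cast d5F_eq 1 (8/3) (-5/3) (-1/2) (24/25) (1/25) (1/10)
/-- `d₅₂`. [cite: Zhang2022LandauSiegel, §10 before (10.14)] -/
theorem d52_eq : d52 = d5val 2 (4/3) (-1/3) (1/2) (12/25) (13/25) (3/10) := by
  unfold d52 gh26 gh27; exact_mod_cast d5F_eq 2 (4/3) (-1/3) (1/2) (12/25) (13/25) (3/10)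
/-- `d₅₃`. [cite: Zhang2022LandauSiegel, §10 before (10.14)] -/
theorem d53_eq : d53 = d5val 3 (8/9) (1/9) (1/6) (8/25) (17/25) (-3/10) := by
  unfold d53 gh36 gh37; exact_mod_cast d5F_eq 3 (8/9) (1/9) (1/6) (8/25) (17/25) (-3/10)

/-- `d′₆₁`. [cite: Zhang2022LandauSiegel, (10.15)] -/
theorem d6p1_eq : d6p1 = d6pval (1/2) := by unfold d6p1 ff16; exact d6pF_eq _
/-- `d′₆₂`. [cite: Zhang2022LandauSiegel, (10.15)] -/
theorem d6p2_eq : d6p2 = d6pval (-1/2) := by unfold d6p2 ff26; exact d6pF_eq _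
/-- `d′₆₃`. [cite: Zhang2022LandauSiegel, (10.15)] -/
theorem d6p3_eq : d6p3 = d6pval (-3/2) := by unfold d6p3 ff36; exact d6pF_eq _

/-- `d₆₁`. [cite: Zhang2022LandauSiegel, §10 after (10.15)] -/
theorem d61_eq : d61 = d6val 6 (1/2) (3/2) 5 (-3) := by
  unfold d61 ff16 ff17 yy11 yy21; exact_mod_cast d6F_eq 6 (1/2) (3/2) 5 (-3)
/-- `d₆₂`. [cite: Zhang2022LandauSiegel, §10 after (10.15)] -/
theorem d62_eq : d62 = d6val 3 (-1/2) (1/2) 4 (-3/2) := by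
  unfold d62 ff26 ff27 yy12 yy22; exact_mod_cast d6F_eq 3 (-1/2) (1/2) 4 (-3/2)
/-- `d₆₃`. [cite: Zhang2022LandauSiegel, §10 after (10.15)] -/
theorem d63_eq : d63 = d6val 2 (-3/2) (-1/2) 3 (-1) := by
  unfold d63 ff36 ff37 yy13 yy23; exact_mod_cast d6F_eq 2 (-3/2) (-1/2) 3 (-1)

/-- `d₇₁`. [cite: Zhang2022LandauSiegel, §18 proof of (2.33)] -/
theorem d71_eq : d71 = d7val 1 5 (-3) 5 (-3) yy2Q := by
  unfold d71 yy11 yy21; exact_mod_cast d7F_eq 1 5 (-3)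
/-- `d₇₂`. [cite: Zhang2022LandauSiegel, §18 proof of (2.33)] -/
theorem d72_eq : d72 = d7val 2 4 (-3/2) 4 (-3/2) yy2Q := by
  unfold d72 yy12 yy22; exact_mod_cast d7F_eq 2 4 (-3/2)
/-- `d₇₃`. [cite: Zhang2022LandauSiegel, §18 proof of (2.33)] -/
theorem d73_eq : d73 = d7val 3 3 (-1) 3 (-1) yy2Q := by
  unfold d73 yy13 yy23; exact_mod_cast d7F_eq 3 3 (-1)
/-- `d₇₁`, verbatim reading. [cite: Zhang2022LandauSiegel, §18 proof of (2.33)] -/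
theorem d7lit1_eq : d7lit1 = d7val 1 5 (-3) 5 (-3) yy1Q := by
  unfold d7lit1 yy11; exact_mod_cast d7litF_eq 1 5 (-3)
/-- `d₇₂`, verbatim reading. [cite: Zhang2022LandauSiegel, §18 proof of (2.33)] -/
theorem d7lit2_eq : d7lit2 = d7val 2 4 (-3/2) 4 (-3/2) yy1Q := by
  unfold d7lit2 yy12; exact_mod_cast d7litF_eq 2 4 (-3/2)
/-- `d₇₃`, verbatim reading. [cite: Zhang2022LandauSiegel, §18 proof of (2.33)] -/
theorem d7lit3_eq : d7lit3 = d7val 3 3 (-1) 3 (-1) yy1Q := by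
  unfold d7lit3 yy13; exact_mod_cast d7litF_eq 3 3 (-1)

end Literature.NumberTheory.LFunctions.Zhang2022
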